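import Mathlib
import HarnessLib
import Summits.KontsevichZagierPeriods.KontsevichZagierPeriods.Theses.LinRedNormalForm
import Summits.KontsevichZagierPeriods.KontsevichZagierPeriods.Theorems.LinRedNormalFormDihedralNormalFormStubTorusDescentAux3

/-!
# `DihedralNormalForm`, line `torus-descent-sum-shadow`: stub `stub_torusDescent` (the torus descent move)

The registered stub `stub_torusDescent` of the crux `DihedralNormalForm`
(stmt-KontsevichZagierPeriods-3912, route `LinRedNormalForm`, line `torus-descent-sum-shadow`):
an atom `[□ᵏ⁺¹, q · xᵃ · ∏_{i ≤ j} (1 − x_{[i,j]})^{e i j}]` with a simple descent direction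
`lam ∈ {0, ±1}ᵏ⁺¹` (some `lam p = −1`, orthogonal to every active chord, total weight
`E = Σ lam l (a l + 1) ≠ 0`) is congruent modulo `KZ.relations` to the sum over the entry faces
`p` (`lam p = −1`) of the base representations
`[□ᵏ, (q/E) · g₀(insertNth p 1 y) · (M_p(y)^{−E} − 1)]`, `M_p(y) = max (0, max_{lam = +1} y)`.

The chain of moves, for each entry face `p`: restrict to the entry piece `D_p` (rule 1a over the
finite almost-partition of the cube by the pieces, `KZ.of_sub_sum_of_mem_relations`; the pieces
meet and miss only null coordinate diagonals), relabel `p ↦ last` (rule 2,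
`KZ.of_sub_of_reindex_mem_relations`), straighten the torus orbits by the monomial change of
variables onto the open band (rule 2, `Descent.of_openBandRep_sub_mem`; the pulled-back atom
times the Jacobian IS `bandFun`, `Descent.integrand_transport`, which also transports absolute
convergence), close the band (rule 1, null), and integrate the band coordinate out by ONE
Newton–Leibniz move with a monomial primitive (rule 3, `Descent.of_bandRep_sub_of_baseRep_mem`;
the base converges absolutely by Tonelli and the fibrewise triangle inequality,
`Descent.integrableOn_baseFun`). Tools: `…StubTorusDescentAux1/2/3`.

References: M. Kontsevich, D. Zagier, *Periods* (2001), §1.2 (rules (1)–(3)).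
-/

noncomputable section

open MeasureTheory Set MvPolynomial
open scoped ENNReal
open Literature.ModelTheory.ExponentialFields (IsSemialgebraic)

namespace Summit.KontsevichZagierPeriods.DihedralNormalForm.TorusDescent

open Literature.NumberTheory.Transcendental
open Literature.ModelTheory.ExponentialFields

namespace Descent

variable {k : ℕ} (D : Descent k)

/-- The entry piece `D_p` of the atom, reindexed so that `p` becomes the last coordinate. -/
def pieceRep : KZ.IntegralRep (k + 1) :=
  (D.s.restrict (piece D.lam D.p) (isSemialgebraic_piece D.lam D.p)
    (by rw [D.hdom]; exact piece_subset_openUnitCube D.lam D.p)).reindex (reix D.p)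

/-- Its domain is the wedge of `μ`. [folklore] -/
theorem pieceRep_domain : D.pieceRep.domain = wedge D.dir :=
  setOf_comp_reix_mem_piece D.lam D.p

/-- Its integrand. [folklore] -/
theorem pieceRep_integrand (w : Fin (k + 1) → ℝ) :
    D.pieceRep.integrand w = D.s.integrand fun i => w (reix D.p i) := rfl

/-- Its domain is the image of the open band under the inverse straightening. [folklore] -/
theorem pieceRep_domain_eq_image : D.pieceRep.domain = str (-D.dir) '' wedge (-D.dir) := by
  rw [pieceRep_domain, image_str (neg_mem_signs D.dir_mem_signs), neg_neg]

/-- **The transformed integrand**: pulling the atom back along the inverse straightening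
`(y, s) ↦ x` and multiplying by the Jacobian `s^{−Σ lam − 1}` gives `q · g₀(insertNth p 1 y) ·
s^{−E−1}` on the open band. [folklore] -/
theorem integrand_transport {z : Fin (k + 1) → ℝ} (hz : z ∈ wedge (-D.dir)) :
    D.pieceRep.integrand (str (-D.dir) z) * |(strDeriv (-D.dir) z).det| = D.bandFun z := by
  have ht : 0 < z (Fin.last k) := last_pos_of_mem_wedge hz
  have hmem : str (-D.dir) z ∈ wedge D.dir := by
    simpa using mapsTo_str (neg_mem_signs D.dir_mem_signs) hz
  have hcube : (fun i => str (-D.dir) z (reix D.p i)) ∈ D.s.domain := by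
    rw [D.hdom]; intro i; exact hmem.1 _
  rw [pieceRep_integrand, D.hint hcube, comp_reix_eq_insertNth, str_last, init_str,
    abs_det_strDeriv _ ht]
  dsimp only
  have hfun : (fun j => z (Fin.castSucc j) * z (Fin.last k) ^ (-D.dir) j) =
      fun j => Fin.init z j * z (Fin.last k) ^ (-D.lam (D.p.succAbove j)) := rfl
  have hsum : (∑ j, (-D.dir) j) = -(∑ j, D.lam (D.p.succAbove j)) := by
    simp [dir, Finset.sum_neg_distrib]
  rw [hfun, atomFun_insertNth_scaled D.a D.e D.lam D.p D.hp D.hch (Fin.init z) ht.ne', hsum]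
  unfold bandFun
  rw [show ∀ A B C : ℝ, (D.q : ℝ) * (A * B) * C = (D.q : ℝ) * A * (B * C) from fun A B C => by ring,
    ← zpow_add₀ ht.ne']
  have h1 := Fin.sum_univ_succAbove D.lam D.p
  have h2 : wt D.a D.lam = (∑ l, D.lam l * (D.a l : ℤ)) + ∑ l, D.lam l := by
    unfold wt
    rw [← Finset.sum_add_distrib]
    exact Finset.sum_congr rfl fun l _ => by ring
  rw [D.hp] at h1
  congr 2
  omega

/-- **Integrability of the transformed integrand on the open band** (transport of the atom's
absolute convergence by `MeasureTheory.integrableOn_image_iff_integrableOn_abs_det_fderiv_smul`).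
[folklore] -/
theorem integrableOn_bandFun_wedge : IntegrableOn D.bandFun (wedge (-D.dir)) := by
  have h1 : IntegrableOn D.pieceRep.integrand (str (-D.dir) '' wedge (-D.dir)) := by
    rw [← pieceRep_domain_eq_image]
    exact D.pieceRep.integrableOn
  have h2 := (integrableOn_image_iff_integrableOn_abs_det_fderiv_smul volume
    (measurableSet_wedge _)
    (fun z hz => (hasFDerivAt_str (-D.dir) (last_pos_of_mem_wedge hz).ne').hasFDerivWithinAt)
    (injOn_str (-D.dir)) D.pieceRep.integrand).mp h1
  refine h2.congr_fun (fun z hz => ?_) (measurableSet_wedge _)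
  dsimp only
  rw [smul_eq_mul, mul_comm]
  exact D.integrand_transport hz

/-- Integrability on the closed band (a null modification). [folklore] -/
theorem integrableOn_bandFun_closedBand : IntegrableOn D.bandFun D.closedBand :=
  D.integrableOn_bandFun_wedge.congr_set_ae (ae_eq_set.2 ⟨D.volume_closedBand_diff, D.volume_wedge_diff⟩)

/-- **Absolute convergence of the base** (Tonelli along the fibres and the fibrewise triangle
inequality). [folklore] -/
theorem integrableOn_baseFun : IntegrableOn (baseFun D.q D.a D.e D.lam D.p) (openUnitCube k) := by
  have hS : MeasurableSet (openUnitCube k) :=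
    IsSemialgebraic.measurableSet_holds isSemialgebraic_openUnitCube
  refine integrableOn_of_lintegral_fibre_ge hS D.measurableSet_closedBand
    (fun x t => KZlog.snoc_mem_band) D.integrableOn_bandFun_closedBand
    (KZ.aestronglyMeasurable_of_isSemialgebraicFunOn D.isSemialgebraicFunOn_baseFun hS)
    fun y hy => D.enorm_baseFun_le hy

/-! ### The three representations and the three moves -/

/-- The transformed atom on the open band. -/
def openBandRep : KZ.IntegralRep (k + 1) :=
  ⟨wedge (-D.dir), D.bandFun, isSemialgebraic_wedge _, D.isSemialgebraicFunOn_bandFun (isSemialgebraic_wedge _),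
    D.integrableOn_bandFun_wedge⟩

/-- The transformed atom on the closed band. -/
def bandRep : KZ.IntegralRep (k + 1) :=
  ⟨D.closedBand, D.bandFun, D.isSemialgebraic_closedBand,
    D.isSemialgebraicFunOn_bandFun D.isSemialgebraic_closedBand, D.integrableOn_bandFun_closedBand⟩

/-- **The base representation** `[□ᵏ, (q/E) · g₀(insertNth p 1 y) · (M_p(y)^{−E} − 1)]`. -/
def baseRep : KZ.IntegralRep k :=
  ⟨openUnitCube k, baseFun D.q D.a D.e D.lam D.p, isSemialgebraic_openUnitCube,
    D.isSemialgebraicFunOn_baseFun, D.integrableOn_baseFun⟩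

/-- **Rule (2)**: the open band and the reindexed entry piece differ by the change of variables
`(y, s) ↦ x` (the inverse straightening). [cite: KontsevichZagier2001, §1.2 rule (2)] -/
theorem of_openBandRep_sub_mem : KZ.of D.openBandRep - KZ.of D.pieceRep ∈ KZ.changeOfVariablesRel :=
  ⟨k + 1, D.openBandRep, D.pieceRep, str (-D.dir), strDeriv (-D.dir),
    isSemialgebraicMapOn_str _ (isSemialgebraic_wedge _),
    fun _ hz => (hasFDerivAt_str (-D.dir) (last_pos_of_mem_wedge hz).ne').hasFDerivWithinAt,
    injOn_str _, D.pieceRep_domain_eq_image, fun _ hz => (D.integrand_transport hz).symm, rfl⟩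

/-- **Rule (1)**: closing the band is a null modification. [cite: KontsevichZagier2001, §1.2 rule (1)] -/
theorem of_openBandRep_sub_of_bandRep_mem : KZ.of D.openBandRep - KZ.of D.bandRep ∈ KZ.relations :=
  KZ.of_sub_of_mem_relations_of_null _ _ D.volume_wedge_diff D.volume_closedBand_diff fun _ _ => rfl

/-- **Rule (3)**: ONE Newton–Leibniz move along the straightened orbit, with the monomial primitive
`−(q/E) · g₀ · s^{−E}`, takes the closed band to the base.
[cite: KontsevichZagier2001, §1.2 rule (3)] -/
theorem of_bandRep_sub_of_baseRep_mem : KZ.of D.bandRep - KZ.of D.baseRep ∈ KZ.newtonLeibnizRel := by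
  refine ⟨k, D.bandRep, D.baseRep, topP D.lam D.p, fun _ => 1, D.primFun,
    D.isSemialgebraicFunOn_primFun D.isSemialgebraic_closedBand,
    isSemialgebraicFunOn_topP D.lam D.p isSemialgebraic_openUnitCube D.pos_of_mem_openUnitCube,
    isSemialgebraicFunOn_one_openUnitCube,
    fun y hy => (D.topP_lt_one hy).le, rfl, fun y hy => ?_, fun y hy t ht => ?_, fun y _ => ?_, rfl⟩
  · exact D.continuousOn_primFun_snoc y (D.topP_pos_or_wt_neg hy)
  · exact D.hasDerivAt_primFun y ((D.topP_nonneg_of_mem hy).trans_lt ht.1).ne'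
  · exact D.baseFun_eq y

/-- **The descent through the face `p`**: the entry piece `[D_p, g]` of the atom is KZ-equivalent
to the base representation (reindex, straighten, close the band, integrate `s` out).
[cite: KontsevichZagier2001, §1.2] -/
theorem of_restrict_sub_of_baseRep_mem :
    KZ.of (D.s.restrict (piece D.lam D.p) (isSemialgebraic_piece D.lam D.p)
      (by rw [D.hdom]; exact piece_subset_openUnitCube D.lam D.p)) - KZ.of D.baseRep ∈
      KZ.relations := by
  have e1 := KZ.of_sub_of_reindex_mem_relations (D.s.restrict (piece D.lam D.p)
    (isSemialgebraic_piece D.lam D.p) (by rw [D.hdom]; exact piece_subset_openUnitCube D.lam D.p))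
    (reix D.p)
  have e2 : KZ.of D.pieceRep - KZ.of D.openBandRep ∈ KZ.relations := by
    rw [← neg_sub]
    exact KZ.relations.neg_mem (KZ.changeOfVariablesRel_subset_relations D.of_openBandRep_sub_mem)
  have e3 := D.of_openBandRep_sub_of_bandRep_mem
  have e4 := KZ.newtonLeibnizRel_subset_relations D.of_bandRep_sub_of_baseRep_mem
  have key := KZ.relations.add_mem (KZ.relations.add_mem (KZ.relations.add_mem e1 e2) e3) e4
  convert key using 1
  simp only [pieceRep]
  abel

end Descent

/-! ### The dissection of the cube by the entry face -/

variable {k : ℕ}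

/-- **The entry pieces cover the cube up to the coordinate diagonals**: off `⋃ {x_l = x_p}` every
point of the open cube has a unique largest `−1`-coordinate. [folklore] -/
theorem volume_openUnitCube_diff_pieces (lam : Fin (k + 1) → ℤ) (hne : ∃ p, lam p = -1) :
    volume (openUnitCube (k + 1) \
      ⋃ p ∈ Finset.univ.filter (fun p : Fin (k + 1) => lam p = -1), piece lam p) = 0 := by
  classical
  have hsub : openUnitCube (k + 1) \
      (⋃ p ∈ Finset.univ.filter (fun p : Fin (k + 1) => lam p = -1), piece lam p) ⊆
      ⋃ l : Fin (k + 1), ⋃ p : Fin (k + 1), {x : Fin (k + 1) → ℝ | l ≠ p ∧ x l = x p} := by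
    rintro x ⟨hx, hnot⟩
    obtain ⟨p₀, hp₀, hmax⟩ := Finset.exists_max_image
      (Finset.univ.filter fun p : Fin (k + 1) => lam p = -1) x
      (by obtain ⟨p, hp⟩ := hne; exact ⟨p, by simp [hp]⟩)
    have hp₀' : lam p₀ = -1 := by simpa using hp₀
    have hx' : x ∉ piece lam p₀ := fun h => hnot (by
      simp only [mem_iUnion, Finset.mem_filter, Finset.mem_univ, true_and, exists_prop]
      exact ⟨p₀, hp₀', h⟩)
    have hx'' : ¬ ∀ l, l ≠ p₀ → lam l = -1 → x l < x p₀ := fun h => hx' ⟨hx, h⟩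
    push Not at hx''
    obtain ⟨l, hl, hlam, hle⟩ := hx''
    refine mem_iUnion.2 ⟨l, mem_iUnion.2 ⟨p₀, hl, le_antisymm (hmax l (by simp [hlam])) hle⟩⟩
  refine measure_mono_null hsub (measure_iUnion_null_iff.2 fun l =>
    measure_iUnion_null_iff.2 fun p => ?_)
  by_cases hlp : l = p
  · have h : {x : Fin (k + 1) → ℝ | l ≠ p ∧ x l = x p} = ∅ := by
      ext x; simp [hlp]
    rw [h, measure_empty]
  · have h : {x : Fin (k + 1) → ℝ | l ≠ p ∧ x l = x p} = {x | x l = x p} := by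
      ext x; simp [hlp]
    rw [h]
    exact volume_setOf_apply_eq_apply hlp

/-- Distinct entry pieces are disjoint. [folklore] -/
theorem piece_inter_piece {lam : Fin (k + 1) → ℤ} {p p' : Fin (k + 1)} (hp : lam p = -1)
    (hp' : lam p' = -1) (hne : p ≠ p') : piece lam p ∩ piece lam p' = ∅ := by
  ext x
  simp only [mem_inter_iff, mem_empty_iff_false, iff_false, not_and]
  intro h h'
  exact lt_asymm (h.2 p' (Ne.symm hne) hp') (h'.2 p hne hp)

/-- **`stub_torusDescent`** — THE MOVE of the line `torus-descent-sum-shadow`. For a simple descent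
direction `lam` of the atom `[□ᵏ⁺¹, q · xᵃ · ∏ (1 − x_{[i,j]})^{e i j}]`: dissect the cube by the
entry face of the torus orbit (rule 1a, pieces `{x_p = max_{lam = −1} x}`, null diagonals),
relabel coordinates so that `p` is last (rule 2, a permutation), straighten each piece by the
monomial map `y_l = x_l · x_p^{lam l}`, `s = x_p` (rule 2, Jacobian `s^{−Σ lam − 1}`) onto the band
`{M_p(y) ≤ s ≤ 1}` over `□ᵏ`, where the integrand is `q · g₀(insertNth p 1 y) · s^{−E−1}`, close
the band (rule 1, null), and integrate `s` out by ONE Newton–Leibniz move with the monomial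
primitive `−(q/E) · g₀ · s^{−E}` (rule 3); the base over the face `p` is
`[□ᵏ, (q/E) · g₀(insertNth p 1 y) · (M_p(y)^{−E} − 1)]`, absolutely convergent by Tonelli and the
fibrewise triangle inequality. [cite: KontsevichZagier2001, §1.2] -/
theorem stub_torusDescent : ∀ (k : ℕ) (q : ℚ) (a : Fin (k + 1) → ℕ) (e : Fin (k + 1) → Fin (k + 1) → ℤ) (lam : Fin (k + 1) → ℤ) (s : Literature.NumberTheory.Transcendental.KZ.IntegralRep (k + 1)), s.domain = {x : Fin (k + 1) → ℝ | ∀ i, x i ∈ Set.Ioo (0:ℝ) 1} → Set.EqOn s.integrand (fun x => (q : ℝ) * ((∏ i : Fin (k + 1), x i ^ a i) * ∏ i : Fin (k + 1), ∏ j : Fin (k + 1), if i ≤ j then (1 - (∏ l : Fin (k + 1), if i ≤ l ∧ l ≤ j then x l else 1)) ^ e i j else 1)) s.domain → (∀ l : Fin (k + 1), lam l = 0 ∨ lam l = 1 ∨ lam l = -1) → (∃ p : Fin (k + 1), lam p = -1) → (∀ i j : Fin (k + 1), i ≤ j → e i j ≠ 0 → (∑ l : Fin (k + 1), if i ≤ l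 ∧ l ≤ j then lam l else 0) = 0 ∧ (Finset.univ.filter (fun l : Fin (k + 1) => i ≤ l ∧ l ≤ j ∧ lam l = 1)).card ≤ 1) → (∑ l : Fin (k + 1), lam l * ((a l : ℤ) + 1)) ≠ 0 → ∃ B : Fin (k + 1) → Literature.NumberTheory.Transcendental.KZ.IntegralRep k, (∀ p : Fin (k + 1), lam p = -1 → (B p).domain = {y : Fin k → ℝ | ∀ i, y i ∈ Set.Ioo (0:ℝ) 1} ∧ Set.EqOn (B p).integrand (fun y => ((q / (((∑ l : Fin (k + 1), lam l * ((a l : ℤ) + 1)) : ℤ) : ℚ) : ℚ) : ℝ) * ((∏ i : Fin (k + 1), (Fin.insertNth p (1:ℝ) y) i ^ a i) * ∏ i : Fin (k + 1), ∏ j : Fin (k + 1), if i ≤ j then (1 - (∏ l : Fin (k + 1), if i ≤ l ∧ l ≤ j then (Fin.insertNth p (1:ℝ) y) l else 1)) ^ e i j else 1) * ((⨆ j : Fin k, if lam (Fin.succAbove p j) = 1 then y j else (0:ℝ)) ^ (-(∑ l : Fin (k + 1), lam l * ((a l : ℤ) + 1))) - 1)) (B p).domain) ∧ Literature.NumberTheory.Transcendental.KZ.of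 s - (∑ p : Fin (k + 1), if lam p = -1 then Literature.NumberTheory.Transcendental.KZ.of (B p) else 0) ∈ Literature.NumberTheory.Transcendental.KZ.relations := by
  intro k q a e lam s hdom hint hlam hex hch hE
  classical
  have hch0 : ∀ i j : Fin (k + 1), i ≤ j → e i j ≠ 0 →
      (∑ l : Fin (k + 1), if i ≤ l ∧ l ≤ j then lam l else 0) = 0 :=
    fun i j hij he => (hch i j hij he).1
  -- the descent data through each entry face
  let D : ∀ p : Fin (k + 1), lam p = -1 → Descent k := fun p hp =>
    ⟨q, a, e, lam, p, s, hdom, hint, hlam, hp, hch0, hE⟩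
  set B : Fin (k + 1) → KZ.IntegralRep k := fun p =>
    if h : lam p = -1 then (D p h).baseRep else KZ.IntegralRep.empty k with hB
  refine ⟨B, fun p hp => ?_, ?_⟩
  · simp only [hB, dif_pos hp]
    exact ⟨rfl, fun y _ => rfl⟩
  · set P : Finset (Fin (k + 1)) := Finset.univ.filter fun p : Fin (k + 1) => lam p = -1 with hP
    have hsum : (∑ p : Fin (k + 1), if lam p = -1 then KZ.of (B p) else 0) = ∑ p ∈ P, KZ.of (B p) := by
      rw [hP, Finset.sum_filter]
    rw [hsum]
    -- rule (1a): dissect the cube by the entry face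
    let R : Fin (k + 1) → KZ.IntegralRep (k + 1) := fun p =>
      s.restrict (piece lam p) (isSemialgebraic_piece lam p)
        (by rw [hdom]; exact piece_subset_openUnitCube lam p)
    have hdis : KZ.of s - ∑ p ∈ P, KZ.of (R p) ∈ KZ.relations := by
      refine KZ.of_sub_sum_of_mem_relations P s R (fun p _ => ?_) (fun p _ _ _ => rfl) ?_ ?_
      · show volume (piece lam p \ s.domain) = 0
        rw [hdom]
        exact measure_mono_null (fun x hx => (hx.2 (piece_subset_openUnitCube lam p hx.1)).elim)
          (measure_empty (μ := volume))
      · show volume (s.domain \ ⋃ p ∈ P, piece lam p) = 0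
        rw [hdom]
        exact volume_openUnitCube_diff_pieces lam hex
      · intro p hp p' hp' hne
        show volume (piece lam p ∩ piece lam p') = 0
        rw [piece_inter_piece (by simpa [hP] using hp) (by simpa [hP] using hp') hne, measure_empty]
    -- rules (2), (1), (3): descend each piece to its base
    have hdesc : ∀ p ∈ P, KZ.of (R p) - KZ.of (B p) ∈ KZ.relations := fun p hp => by
      have hp' : lam p = -1 := by simpa [hP] using hp
      simp only [hB, dif_pos hp']
      exact (D p hp').of_restrict_sub_of_baseRep_mem
    have key := KZ.relations.add_mem hdis (KZ.sum_sub_sum_mem_relations P _ _ hdesc)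
    convert key using 1
    abel

end Summit.KontsevichZagierPeriods.DihedralNormalForm.TorusDescent
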